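import Literature.Probability.RandomPlanarGeometry.SLERealFlowGenerator
import Literature.Probability.RandomPlanarGeometry.SLEOnePointNonSwallowingProofs
import Literature.Probability.RandomPlanarGeometry.SLEOnePointSwallowingProofs
import Literature.Probability.RandomPlanarGeometry.LoewnerBoundaryExtension
import Literature.Analysis.FunctionSpaces.ItoMartingale
import HarnessLib

/-!
# The logarithmic one-point martingale of the real SLE_κ flow and `sup_t log (g_t'(x)/g_t'(y)) < ∞` for `κ < 4`

Trunk T-STOCH. Stochastic input for Rohde–Schramm's Lemma 7.2 (*Basic properties of SLE*,
Ann. of Math. 161 (2005), p. 909) in the case `κ < 4`, through the Koebe route of its printed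
`κ = 4` argument ("it suffices to show that a.s. `sup_{t ≥ 0} g_t'(x)/(g_t(x) - g_t(y)) < ∞`";
here we control `sup_t g_t'(x)/g_t'(y)`, which dominates it by the mean-value bound
`g_t(x) - g_t(y) ≥ (x - y) g_t'(y)`).

For the real SLE_κ flow `X_t = g_t(x) - √κ B_t` from `x > 0` (`sleRealFlowStop κ x`, frozen at
`0` from `T_x` on) one has `dX = (2/X) dt - √κ dB` and `∂_t log g_t'(x) = -2/X_t²`, so that

  `log g_t'(x) + (4/(4-κ)) log X_t`

is a local martingale (`d log X = (2 - κ/2) X⁻² dt - X⁻¹ √κ dB` and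
`(4/(4-κ)) (2 - κ/2) = 2`). We **prove**:

* `martingale_log_stoppedProcess_sub_timeIntegral` — for `0 < δ < x < R` and any stopping time
  `ρ` before the exit time of `X` from `(δ, R)`, the process
  `log X_{t∧ρ} - ∫₀^{t∧ρ} (2 - κ/2)/X_s² ds` is a martingale (Itô's formula for Itô processes,
  `Literature.Analysis.FunctionSpaces.martingale_apply_sub_timeIntegral`, along the stopped flow,
  an Itô process by `isItoProcess_stoppedProcess_sleRealFlowStop`);
* `sleTwoFlowExit κ x y δ R` — the first exit of either flow (from `x` or from `y`) from
  `(δ, R)`; `sleLogDerivRate` — the stopped integrated rates `A^z_t = ∫₀^{t∧ρ} 2/Z_s² ds`;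
  `sleLogDerivObs` — the observable `Z_t = c (log X_{t∧ρ} - log Y_{t∧ρ}) + (A^y_t - A^x_t)`,
  `c = 4/(4-κ)`, a martingale (`martingale_sleLogDerivObs`) with `Z_0 = c log(x/y)`
  (`sleLogDerivObs_zero`), non-negative and dominating `A^y - A^x ≥ 0`
  (`sleLogDerivRate_sub_le_sleLogDerivObs`, `sleLogDerivRate_sub_nonneg`: `0 < Y ≤ X` up to
  `ρ`, `sleRealFlowStop_le_of_le_sleTwoFlowExit`);
* `measureReal_le_sleLogDerivRate_sub_le` — Markov's inequality:
  `P[λ ≤ A^y_N - A^x_N] ≤ c log(x/y)/λ`;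
* `sleLogDerivRaw κ x y t = ∫₀ᵗ (2/Y_s² - 2/X_s²) ds` (no stopping) and
  `ae_exists_forall_sleLogDerivRaw_le`, `ae_exists_forall_integral_realFlow_rate_le` — **for
  `0 < κ < 4` and `0 < y ≤ x`, almost surely `sup_t ∫₀ᵗ (2/Y_s² - 2/X_s²) ds < ∞`** (letting
  `δ → 0`, `R → ∞` through the box events `sleFlowsInBox`: both flows are a.s. never swallowed
  for `κ ≤ 4`, `ae_sle_swallowingTime_eq_top_of_le_four`, so on `[0, N]` they stay in some box,
  where the stopped functional is the raw one, `sleLogDerivRate_sub_eq_raw`; then `N → ∞` by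
  monotonicity, `sleLogDerivRaw_mono`).

Combined with the deterministic Koebe bound of `LoewnerRealKoebe`
(`dist(x', γ[0,t]) ≥ (x' - y') g_t'(y') / (4 g_t'(x))`), this yields Lemma 7.2 for `κ < 4`
downstream.

## References

* S. Rohde, O. Schramm, *Basic properties of SLE*, Ann. of Math. 161 (2005), proof of
  Lemma 7.2 (p. 909), eq. (3.3).
* G. F. Lawler, *Conformally Invariant Processes in the Plane*, AMS (2005), §1.10 (Bessel
  flow, proof of Prop. 1.21), §6.2 eq. (6.3).
* D. Revuz, M. Yor, *Continuous Martingales and Brownian Motion* (1999), Ch. IV Thm (3.3).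
-/

noncomputable section

open MeasureTheory ProbabilityTheory Filter Set Topology
open scoped NNReal ENNReal

namespace Literature.Probability.RandomPlanarGeometry

open Loewner Literature.Probability.Process Literature.Analysis.FunctionSpaces

variable {κ : ℝ≥0} {x y δ R : ℝ}

/-! ### Stopping before the exit time: pathwise facts -/

/-- A process stopped at a random time `ρ` before its exit time from `(a, b)` stays in `[a, b]`
(continuous path started inside). [folklore] -/
theorem stoppedProcess_mem_Icc_of_le_exitTime {u : ℝ≥0 → (ℝ≥0 → ℝ) → ℝ} {a b : ℝ} {ω : ℝ≥0 → ℝ}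
    (hc : Continuous fun t ↦ u t ω) (h0 : u 0 ω ∈ Ioo a b) {ρ : (ℝ≥0 → ℝ) → WithTop ℝ≥0}
    (hρ : ρ ω ≤ exitTime u a b ω) (t : ℝ≥0) : stoppedProcess u ρ t ω ∈ Icc a b := by
  set s : ℝ≥0 := (min (t : WithTop ℝ≥0) (ρ ω)).untopA with hs
  have hsρ : (s : WithTop ℝ≥0) ≤ exitTime u a b ω := (coe_untopA_min_le t (ρ ω)).trans hρ
  have h1 : stoppedProcess u ρ t ω = u s ω := rfl
  rw [h1, ← stoppedProcess_exitTime_eq_of_le hsρ]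
  exact stoppedProcess_exitTime_mem_Icc hc h0 s

/-- The frozen real SLE_κ flow from `x ∈ (δ, R)` is in `[δ, R]` at every time `≤` a random time
`ρ` before its exit time from `(δ, R)`. [folklore] -/
theorem sleRealFlowStop_mem_Icc_of_le (hx : 0 < x) (hδx : δ < x) (hxR : x < R)
    {ρ : (ℝ≥0 → ℝ) → WithTop ℝ≥0} {ω : ℝ≥0 → ℝ}
    (hρ : ρ ω ≤ exitTime (sleRealFlowStop κ x) δ R ω) {t : ℝ≥0} (ht : (t : WithTop ℝ≥0) ≤ ρ ω) :
    sleRealFlowStop κ x t ω ∈ Icc δ R := by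
  have h := stoppedProcess_mem_Icc_of_le_exitTime (continuous_sleRealFlowStop hx.ne' ω)
    (by rw [sleRealFlowStop_zero_apply hx.ne']; exact ⟨hδx, hxR⟩) hρ t
  rwa [stoppedProcess_eq_of_le ht] at h

/-- The stopped frozen flow stays in `[δ, R]` when stopped before the exit time. [folklore] -/
theorem stoppedProcess_sleRealFlowStop_mem_Icc_of_le (hx : 0 < x) (hδx : δ < x) (hxR : x < R)
    {ρ : (ℝ≥0 → ℝ) → WithTop ℝ≥0} (hρ : ∀ ω, ρ ω ≤ exitTime (sleRealFlowStop κ x) δ R ω)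
    (t : ℝ≥0) (ω : ℝ≥0 → ℝ) : stoppedProcess (sleRealFlowStop κ x) ρ t ω ∈ Icc δ R :=
  stoppedProcess_mem_Icc_of_le_exitTime (continuous_sleRealFlowStop hx.ne' ω)
    (by rw [sleRealFlowStop_zero_apply hx.ne']; exact ⟨hδx, hxR⟩) (hρ ω) t

/-! ### The logarithmic martingale of one stopped flow -/

/-- **`log X_{t∧ρ} - ∫₀^{t∧ρ} (2 - κ/2)/X_s² ds` is a martingale** for the frozen real SLE_κ flow
`X` from `x`, levels `0 < δ < x < R` and a stopping time `ρ` before the exit time of `X` from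
`(δ, R)`. Itô's formula (`martingale_apply_sub_timeIntegral`) for a `C²` modification of `log`
off `[δ, R]` along the Itô process `X^ρ` (`isItoProcess_stoppedProcess_sleRealFlowStop`:
`dX = (2/X) dt - √κ dB` up to `ρ`), with drift `(2/X)(1/X) + ½ κ (-1/X²) = (2 - κ/2)/X²`.
Rohde–Schramm (2005), proof of Lemma 7.2 ("A straightforward application of Itô's formula");
Lawler (2005), §1.10. [cite: RohdeSchramm2005, proof of Lemma 7.2 (p. 909)] -/
theorem martingale_log_stoppedProcess_sub_timeIntegral (hx : 0 < x) (hδ : 0 < δ) (hδx : δ < x)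
    (hxR : x < R) {ρ : (ℝ≥0 → ℝ) → WithTop ℝ≥0} (hρst : IsStoppingTime brownianFiltration ρ)
    (hρ : ∀ ω, ρ ω ≤ exitTime (sleRealFlowStop κ x) δ R ω) :
    Martingale (fun t ω ↦ Real.log (stoppedProcess (sleRealFlowStop κ x) ρ t ω) -
        timeIntegral (trunc ρ fun s ω ↦
          (2 - (κ : ℝ) / 2) / stoppedProcess (sleRealFlowStop κ x) ρ s ω ^ 2) t ω)
      brownianFiltration preWienerMeasure := by
  set X := sleRealFlowStop κ x with hX
  set V := stoppedProcess X ρ with hV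
  set b : ℝ≥0 → (ℝ≥0 → ℝ) → ℝ := trunc ρ fun s ω ↦ 2 / V s ω with hb
  set σ' : ℝ≥0 → (ℝ≥0 → ℝ) → ℝ := trunc ρ fun _ _ ↦ -Real.sqrt κ with hσ'
  have hρ' : ∀ t : ℝ≥0, MeasurableSet[brownianFiltration t] {ω | ρ ω < t} :=
    fun t ↦ hρst.measurableSet_lt t
  have hVmem : ∀ t ω, V t ω ∈ Icc δ R := stoppedProcess_sleRealFlowStop_mem_Icc_of_le hx hδx hxR hρ
  have hXne : ∀ ω (t : ℝ≥0), (t : WithTop ℝ≥0) ≤ ρ ω → X t ω ≠ 0 := fun ω t ht ↦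
    (hδ.trans_le (sleRealFlowStop_mem_Icc_of_le hx hδx hxR (hρ ω) ht).1).ne'
  have hVito : IsItoProcess V b σ' brownian brownianFiltration preWienerMeasure :=
    isItoProcess_stoppedProcess_sleRealFlowStop hx.ne' hρst hXne
  have hVc : ∀ ω, Continuous (V · ω) := fun ω ↦
    continuous_stoppedProcess_apply (continuous_sleRealFlowStop hx.ne' ω) ρ
  have hVa : StronglyAdapted brownianFiltration V :=
    (isStronglyProgressive_sleRealFlowStop κ hx.ne').stronglyAdapted_stoppedProcess hρst
  have hVprog : IsStronglyProgressive brownianFiltration V := hVa.isStronglyProgressive_of_continuous hVc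
  have hbprog : IsStronglyProgressive brownianFiltration b := by
    refine isStronglyProgressive_trunc ?_ hρ'
    have hF : Measurable (Function.uncurry fun (_ : ℝ) (v : ℝ) ↦ 2 / v) :=
      measurable_const.div measurable_snd
    exact IsStronglyProgressive.comp_measurable₂ hVprog (F := fun _ v ↦ 2 / v) hF
  have hσ'prog : IsStronglyProgressive brownianFiltration σ' :=
    isStronglyProgressive_trunc (isStronglyProgressive_const _ _) hρ'
  have hV0 : ∀ ω, V 0 ω = x := fun ω ↦ by
    rw [hV, stoppedProcess, untopA_min_zero, hX, sleRealFlowStop_zero_apply hx.ne']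
  have hσ'bd : ∀ t ω, |σ' t ω| ≤ Real.sqrt κ := abs_trunc_neg_sqrt_le κ ρ
  -- a `C²` function equal to `log` near `[δ, R]`
  obtain ⟨F, hF, hFeq⟩ := exists_contDiff_eventuallyEq_of_pos (n := 2) hδ (hδx.trans hxR).le
    (g := Real.log) fun u hu ↦ Real.contDiffAt_log.2 hu.ne'
  have hFlog : ∀ u ∈ Icc δ R, F u = Real.log u := fun u hu ↦ (hFeq u hu).eq_of_nhds
  have hF1 : ∀ u ∈ Icc δ R, deriv F u = u⁻¹ := fun u hu ↦ by
    rw [(hFeq u hu).deriv_eq, Real.deriv_log]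
  have hF2 : ∀ u ∈ Icc δ R, iteratedDeriv 2 F u = -(u ^ 2)⁻¹ := by
    intro u hu
    have hu0 : u ≠ 0 := (hδ.trans_le hu.1).ne'
    have h1 : deriv F =ᶠ[𝓝 u] fun v ↦ v⁻¹ := by
      have hev : ∀ᶠ v in 𝓝 u, F =ᶠ[𝓝 v] Real.log := (hFeq u hu).eventually_nhds
      filter_upwards [hev] with v hv
      rw [hv.deriv_eq, Real.deriv_log]
    rw [iteratedDeriv_succ, iteratedDeriv_one, h1.deriv_eq, deriv_inv]
  have hmart := martingale_apply_sub_timeIntegral hF hVa hVc hbprog hσ'prog hVito hV0 hVmem hσ'bd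
  -- identify `F(V)` with `log V` and the Itô drift with `(2 - κ/2)/V² 𝟙_{[0,ρ]}`
  have hdrift : ∀ s ω, b s ω * deriv F (V s ω) + 2⁻¹ * σ' s ω ^ 2 * iteratedDeriv 2 F (V s ω) =
      trunc ρ (fun s ω ↦ (2 - (κ : ℝ) / 2) / V s ω ^ 2) s ω := by
    intro s ω
    rw [hF1 _ (hVmem s ω), hF2 _ (hVmem s ω), hb, hσ', trunc_apply, trunc_apply, trunc_apply]
    have hVne : V s ω ≠ 0 := (hδ.trans_le (hVmem s ω).1).ne'
    split_ifs with h
    · rw [neg_sq, Real.sq_sqrt κ.coe_nonneg]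
      field_simp
      ring
    · simp
  have heq : (fun t ω ↦ F (V t ω) - timeIntegral (fun s ω ↦ b s ω * deriv F (V s ω) +
      2⁻¹ * σ' s ω ^ 2 * iteratedDeriv 2 F (V s ω)) t ω) =
      fun t ω ↦ Real.log (V t ω) -
        timeIntegral (trunc ρ fun s ω ↦ (2 - (κ : ℝ) / 2) / V s ω ^ 2) t ω := by
    funext t ω
    rw [hFlog _ (hVmem t ω)]
    congr 1
    simp only [timeIntegral, hdrift]
  rw [heq] at hmart
  exact hmart

/-! ### The two-flow exit time and the observable `Z` -/

/-- The **first exit of either frozen flow (from `x` or from `y`) from `(δ, R)`**: the minimum of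
the two exit times, a stopping time of the raw Brownian filtration. [folklore] -/
def sleTwoFlowExit (κ : ℝ≥0) (x y δ R : ℝ) (ω : ℝ≥0 → ℝ) : WithTop ℝ≥0 :=
  min (exitTime (sleRealFlowStop κ x) δ R ω) (exitTime (sleRealFlowStop κ y) δ R ω)

/-- `sleTwoFlowExit ≤` the exit time of the flow from `x`. [folklore] -/
theorem sleTwoFlowExit_le_left (κ : ℝ≥0) (x y δ R : ℝ) (ω : ℝ≥0 → ℝ) :
    sleTwoFlowExit κ x y δ R ω ≤ exitTime (sleRealFlowStop κ x) δ R ω := min_le_left _ _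

/-- `sleTwoFlowExit ≤` the exit time of the flow from `y`. [folklore] -/
theorem sleTwoFlowExit_le_right (κ : ℝ≥0) (x y δ R : ℝ) (ω : ℝ≥0 → ℝ) :
    sleTwoFlowExit κ x y δ R ω ≤ exitTime (sleRealFlowStop κ y) δ R ω := min_le_right _ _

/-- `sleTwoFlowExit` is a stopping time. [folklore] -/
theorem isStoppingTime_sleTwoFlowExit (κ : ℝ≥0) (hx : 0 < x) (hy : 0 < y) (δ R : ℝ) :
    IsStoppingTime brownianFiltration (sleTwoFlowExit κ x y δ R) :=
  (isStoppingTime_exitTime_sleRealFlowStop κ hx δ R).min (isStoppingTime_exitTime_sleRealFlowStop κ hy δ R)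

/-- The **integrated rate `A^x_t = ∫₀^{t∧ρ} 2/X_s² ds`** of the flow from `x`, stopped at
`ρ = sleTwoFlowExit κ x y δ R` (time integral of the truncated rate `2/X² 𝟙_{[0,ρ]}`); for
`t ≤ ρ` it is `-log g_t'(x)` (eq. (3.3) at a real point). [cite: RohdeSchramm2005, eq. (3.3)] -/
def sleLogDerivRate (κ : ℝ≥0) (z x y δ R : ℝ) : ℝ≥0 → (ℝ≥0 → ℝ) → ℝ :=
  timeIntegral (trunc (sleTwoFlowExit κ x y δ R) fun s ω ↦
    2 / stoppedProcess (sleRealFlowStop κ z) (sleTwoFlowExit κ x y δ R) s ω ^ 2)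

/-- The **logarithmic two-point observable**
`Z_t = (4/(4-κ)) (log X_{t∧ρ} - log Y_{t∧ρ}) + (A^y_t - A^x_t)`, `ρ = sleTwoFlowExit κ x y δ R`:
a martingale (`martingale_sleLogDerivObs`) dominating `A^y - A^x = ∫₀^{·∧ρ} (2/Y² - 2/X²) ds
= log g'(x) - log g'(y)` (up to `ρ`). [cite: RohdeSchramm2005, proof of Lemma 7.2 (p. 909)] -/
def sleLogDerivObs (κ : ℝ≥0) (x y δ R : ℝ) (t : ℝ≥0) (ω : ℝ≥0 → ℝ) : ℝ :=
  4 / (4 - (κ : ℝ)) *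
      (Real.log (stoppedProcess (sleRealFlowStop κ x) (sleTwoFlowExit κ x y δ R) t ω) -
        Real.log (stoppedProcess (sleRealFlowStop κ y) (sleTwoFlowExit κ x y δ R) t ω)) +
    (sleLogDerivRate κ y x y δ R t ω - sleLogDerivRate κ x x y δ R t ω)

/-- Time integrals commute with constant factors (pathwise). [folklore] -/
theorem timeIntegral_const_mul {Ω' : Type*} (c : ℝ) (g : ℝ≥0 → Ω' → ℝ) (t : ℝ≥0) (ω : Ω') :
    timeIntegral (fun s ω ↦ c * g s ω) t ω = c * timeIntegral g t ω := by
  simp only [timeIntegral, intervalIntegral.integral_const_mul]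

/-- Truncation commutes with constant factors. [folklore] -/
theorem trunc_const_mul {Ω' : Type*} (ρ : Ω' → WithTop ℝ≥0) (c : ℝ) (g : ℝ≥0 → Ω' → ℝ) :
    trunc ρ (fun s ω ↦ c * g s ω) = fun s ω ↦ c * trunc ρ g s ω := by
  funext s ω
  simp only [trunc_apply]
  split_ifs <;> simp

section Obs

variable (hκ4 : κ ≠ 4) (hδ : 0 < δ) (hδy : δ < y) (hyx : y ≤ x) (hxR : x < R)
include hδ hδy hyx hxR

include hκ4 in
/-- **`Z` is a martingale**: `Z = c (Mˣ - Mʸ)` for the logarithmic martingales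
`M = log V - ∫ (2-κ/2)/V²` of the two stopped flows (`martingale_log_stoppedProcess_sub_timeIntegral`)
and `c = 4/(4-κ)`, since `c (2 - κ/2)/2 = 1`. [cite: RohdeSchramm2005, proof of Lemma 7.2 (p. 909)] -/
theorem martingale_sleLogDerivObs :
    Martingale (sleLogDerivObs κ x y δ R) brownianFiltration preWienerMeasure := by
  have hy : 0 < y := hδ.trans hδy
  have hx : 0 < x := hy.trans_le hyx
  have hρst := isStoppingTime_sleTwoFlowExit κ hx hy δ R
  have hMx := martingale_log_stoppedProcess_sub_timeIntegral hx hδ (hδy.trans_le hyx) hxR hρst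
    (sleTwoFlowExit_le_left κ x y δ R)
  have hMy := martingale_log_stoppedProcess_sub_timeIntegral hy hδ hδy (hyx.trans_lt hxR) hρst
    (sleTwoFlowExit_le_right κ x y δ R)
  have h := (hMx.sub hMy).smul (4 / (4 - (κ : ℝ)))
  have hκ' : (4 : ℝ) - κ ≠ 0 := sub_ne_zero.2 (by exact_mod_cast hκ4.symm)
  have hc : 4 / (4 - (κ : ℝ)) * ((2 - (κ : ℝ) / 2) / 2) = 1 := by
    field_simp
    ring
  -- rewrite `(2-κ/2)/V²` as `((2-κ/2)/2) · (2/V²)` and pull the constant out of the time integrals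
  have hrate : ∀ (V : ℝ≥0 → (ℝ≥0 → ℝ) → ℝ) (t : ℝ≥0) (ω : ℝ≥0 → ℝ),
      timeIntegral (trunc (sleTwoFlowExit κ x y δ R) fun s ω ↦ (2 - (κ : ℝ) / 2) / V s ω ^ 2) t ω =
        (2 - (κ : ℝ) / 2) / 2 *
          timeIntegral (trunc (sleTwoFlowExit κ x y δ R) fun s ω ↦ 2 / V s ω ^ 2) t ω := by
    intro V t ω
    rw [← timeIntegral_const_mul, ← trunc_const_mul]
    congr 2
    funext s ω
    ring
  convert h using 1
  funext t ω
  simp only [sleLogDerivObs, sleLogDerivRate, Pi.smul_apply, Pi.sub_apply, smul_eq_mul, hrate]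
  linear_combination (timeIntegral (trunc (sleTwoFlowExit κ x y δ R) fun s ω ↦
      2 / stoppedProcess (sleRealFlowStop κ x) (sleTwoFlowExit κ x y δ R) s ω ^ 2) t ω -
    timeIntegral (trunc (sleTwoFlowExit κ x y δ R) fun s ω ↦
      2 / stoppedProcess (sleRealFlowStop κ y) (sleTwoFlowExit κ x y δ R) s ω ^ 2) t ω) * hc

omit hxR in
/-- `Z_0 = (4/(4-κ)) (log x - log y)`. [folklore] -/
theorem sleLogDerivObs_zero (ω : ℝ≥0 → ℝ) :
    sleLogDerivObs κ x y δ R 0 ω = 4 / (4 - (κ : ℝ)) * (Real.log x - Real.log y) := by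
  have hy : 0 < y := hδ.trans hδy
  have hx : 0 < x := hy.trans_le hyx
  simp only [sleLogDerivObs, sleLogDerivRate, timeIntegral_apply_zero, sub_self, add_zero,
    stoppedProcess, untopA_min_zero, sleRealFlowStop_zero_apply hx.ne', sleRealFlowStop_zero_apply hy.ne']

/-- **Up to `ρ` the flow from `y` stays below the flow from `x`** (`0 < Y_t ≤ X_t` for
`t ≤ ρ`): both are the true real flows there (`Y_t ≥ δ > 0`, so `t < T_y ≤ T_x`), and the real
flow is increasing in the starting point (`map_ofReal_re_lt_of_lt`). [folklore] -/
theorem sleRealFlowStop_le_of_le_sleTwoFlowExit {ω : ℝ≥0 → ℝ} {t : ℝ≥0}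
    (ht : (t : WithTop ℝ≥0) ≤ sleTwoFlowExit κ x y δ R ω) :
    δ ≤ sleRealFlowStop κ y t ω ∧ sleRealFlowStop κ y t ω ≤ sleRealFlowStop κ x t ω := by
  have hy : 0 < y := hδ.trans hδy
  have hx : 0 < x := hy.trans_le hyx
  have hYmem := sleRealFlowStop_mem_Icc_of_le hy hδy (hyx.trans_lt hxR)
    (sleTwoFlowExit_le_right κ x y δ R ω) ht
  refine ⟨hYmem.1, ?_⟩
  have hW : Continuous (sleDriving κ ω) := continuous_sleDriving κ ω
  have hTy : (t : WithTop ℝ≥0) < swallowingTime (sleDriving κ ω) y :=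
    coe_lt_swallowingTime_of_realFlowStop_ne_zero (W := sleDriving κ ω)
      (by rw [← sleRealFlowStop_apply]; exact (hδ.trans_le hYmem.1).ne')
  have hy0 : sleDriving κ ω 0 < y := by rw [sleDriving_zero]; exact hy
  have hTx : (t : WithTop ℝ≥0) < swallowingTime (sleDriving κ ω) x :=
    lt_of_lt_of_le hTy (swallowingTime_mono_right hW hy0 hyx)
  rw [sleRealFlowStop_apply, sleRealFlowStop_apply, realFlowStop_of_lt hTy, realFlowStop_of_lt hTx,
    realFlow_apply, realFlow_apply]
  rcases eq_or_lt_of_le hyx with h | h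
  · rw [h]
  · linarith [map_ofReal_re_lt_of_lt hW hy0 h hTy hTx]

omit hδy hyx hxR in
/-- The truncated rates `2/V² 𝟙_{[0,ρ]}` of the stopped flows are integrable on every `[0, t]`
(continuous positive paths). [folklore] -/
theorem intervalIntegrable_trunc_rate {z : ℝ} (hz : 0 < z) (hδz : δ < z) (hzR : z < R)
    (hρ : ∀ ω, sleTwoFlowExit κ x y δ R ω ≤ exitTime (sleRealFlowStop κ z) δ R ω)
    (ω : ℝ≥0 → ℝ) (t : ℝ≥0) :
    IntervalIntegrable (fun s : ℝ ↦ trunc (sleTwoFlowExit κ x y δ R) (fun s ω ↦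
      2 / stoppedProcess (sleRealFlowStop κ z) (sleTwoFlowExit κ x y δ R) s ω ^ 2) s.toNNReal ω)
      volume 0 t := by
  have hV := stoppedProcess_sleRealFlowStop_mem_Icc_of_le (κ := κ) hz hδz hzR hρ
  have hc : Continuous fun r : ℝ ↦
      2 / stoppedProcess (sleRealFlowStop κ z) (sleTwoFlowExit κ x y δ R) r.toNNReal ω ^ 2 := by
    refine continuous_const.div (((continuous_stoppedProcess_apply
      (continuous_sleRealFlowStop hz.ne' ω) _).comp continuous_real_toNNReal).pow 2) fun r ↦ ?_
    exact (pow_pos (hδ.trans_le (hV r.toNNReal ω).1) 2).ne'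
  have h := integrableOn_trunc
    (g := fun s ω ↦ 2 / stoppedProcess (sleRealFlowStop κ z) (sleTwoFlowExit κ x y δ R) s ω ^ 2)
    (ρ := sleTwoFlowExit κ x y δ R) (ω := ω) (S := Icc (0 : ℝ) t)
    (hc.continuousOn.integrableOn_compact isCompact_Icc)
  exact (h.mono_set (by rw [uIcc_of_le t.coe_nonneg])).intervalIntegrable

/-- **`0 ≤ A^y_t - A^x_t`** (the rate `2/Y² - 2/X²` is non-negative up to `ρ`, as
`0 < Y ≤ X`). [folklore] -/
theorem sleLogDerivRate_sub_nonneg (t : ℝ≥0) (ω : ℝ≥0 → ℝ) :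
    0 ≤ sleLogDerivRate κ y x y δ R t ω - sleLogDerivRate κ x x y δ R t ω := by
  have hy : 0 < y := hδ.trans hδy
  have hx : 0 < x := hy.trans_le hyx
  have hIy := intervalIntegrable_trunc_rate hδ hy hδy (hyx.trans_lt hxR)
    (sleTwoFlowExit_le_right κ x y δ R) ω t
  have hIx := intervalIntegrable_trunc_rate hδ hx (hδy.trans_le hyx) hxR
    (sleTwoFlowExit_le_left κ x y δ R) ω t
  simp only [sleLogDerivRate, timeIntegral]
  rw [← intervalIntegral.integral_sub hIy hIx]
  refine intervalIntegral.integral_nonneg t.coe_nonneg fun s hs ↦ ?_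
  simp only [trunc_apply]
  split_ifs with h
  · rw [stoppedProcess_eq_of_le h, stoppedProcess_eq_of_le h, sub_nonneg]
    obtain ⟨h1, h2⟩ := sleRealFlowStop_le_of_le_sleTwoFlowExit hδ hδy hyx hxR h
    have hYpos : 0 < sleRealFlowStop κ y s.toNNReal ω := hδ.trans_le h1
    exact div_le_div_of_nonneg_left zero_le_two (pow_pos hYpos 2) (pow_le_pow_left₀ hYpos.le h2 2)
  · simp

/-- **`A^y - A^x ≤ Z`** (pathwise): `log X_{t∧ρ} ≥ log Y_{t∧ρ}`. [folklore] -/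
theorem sleLogDerivRate_sub_le_sleLogDerivObs (hκ : κ < 4) (t : ℝ≥0) (ω : ℝ≥0 → ℝ) :
    sleLogDerivRate κ y x y δ R t ω - sleLogDerivRate κ x x y δ R t ω ≤ sleLogDerivObs κ x y δ R t ω := by
  simp only [sleLogDerivObs]
  have hc : 0 ≤ 4 / (4 - (κ : ℝ)) := by
    have : (κ : ℝ) < 4 := by exact_mod_cast hκ
    exact div_nonneg (by norm_num) (by linarith)
  have hlog : 0 ≤ Real.log (stoppedProcess (sleRealFlowStop κ x) (sleTwoFlowExit κ x y δ R) t ω) -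
      Real.log (stoppedProcess (sleRealFlowStop κ y) (sleTwoFlowExit κ x y δ R) t ω) := by
    simp only [stoppedProcess]
    obtain ⟨h1, h2⟩ := sleRealFlowStop_le_of_le_sleTwoFlowExit hδ hδy hyx hxR
      (coe_untopA_min_le t (sleTwoFlowExit κ x y δ R ω))
    exact sub_nonneg.2 (Real.log_le_log (hδ.trans_le h1) h2)
  nlinarith

/-- `0 ≤ Z` (pathwise). [folklore] -/
theorem sleLogDerivObs_nonneg (hκ : κ < 4) (t : ℝ≥0) (ω : ℝ≥0 → ℝ) :
    0 ≤ sleLogDerivObs κ x y δ R t ω :=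
  (sleLogDerivRate_sub_nonneg hδ hδy hyx hxR t ω).trans
    (sleLogDerivRate_sub_le_sleLogDerivObs hδ hδy hyx hxR hκ t ω)

/-- **Markov's inequality for the stopped functional**: for `0 < κ < 4` and `λ > 0`,
`P[λ ≤ A^y_N - A^x_N] ≤ (4/(4-κ)) log(x/y) / λ` (`A^y - A^x ≤ Z`, `Z ≥ 0` a martingale with
`E Z_N = Z_0 = (4/(4-κ)) (log x - log y)`). [cite: RohdeSchramm2005, proof of Lemma 7.2 (p. 909)] -/
theorem measureReal_le_sleLogDerivRate_sub_le (hκ : κ < 4) (N : ℝ≥0) {lam : ℝ} (hlam : 0 < lam) :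
    preWienerMeasure.real {ω | lam ≤ sleLogDerivRate κ y x y δ R N ω - sleLogDerivRate κ x x y δ R N ω} ≤
      4 / (4 - (κ : ℝ)) * (Real.log x - Real.log y) / lam := by
  haveI := isProbabilityMeasure_preWienerMeasure'
  have hM := martingale_sleLogDerivObs hκ.ne hδ hδy hyx hxR
  have hint : Integrable (sleLogDerivObs κ x y δ R N) preWienerMeasure := hM.integrable N
  have hmarkov := mul_meas_ge_le_integral_of_nonneg
    (ae_of_all _ fun ω ↦ sleLogDerivObs_nonneg hδ hδy hyx hxR hκ N ω) hint lam
  have hE : ∫ ω, sleLogDerivObs κ x y δ R N ω ∂preWienerMeasure =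
      4 / (4 - (κ : ℝ)) * (Real.log x - Real.log y) := by
    rw [integral_eq_of_martingale hM N]
    simp only [sleLogDerivObs_zero hδ hδy hyx, integral_const, smul_eq_mul, probReal_univ,
      one_mul]
  have hmono : preWienerMeasure.real {ω | lam ≤ sleLogDerivRate κ y x y δ R N ω -
      sleLogDerivRate κ x x y δ R N ω} ≤ preWienerMeasure.real {ω | lam ≤ sleLogDerivObs κ x y δ R N ω} :=
    measureReal_mono fun ω hω ↦ le_trans hω (sleLogDerivRate_sub_le_sleLogDerivObs hδ hδy hyx hxR hκ N ω)
  rw [le_div_iff₀ hlam]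
  calc preWienerMeasure.real {ω | lam ≤ sleLogDerivRate κ y x y δ R N ω - sleLogDerivRate κ x x y δ R N ω} * lam
      ≤ preWienerMeasure.real {ω | lam ≤ sleLogDerivObs κ x y δ R N ω} * lam :=
        mul_le_mul_of_nonneg_right hmono hlam.le
    _ = lam * preWienerMeasure.real {ω | lam ≤ sleLogDerivObs κ x y δ R N ω} := mul_comm _ _
    _ ≤ 4 / (4 - (κ : ℝ)) * (Real.log x - Real.log y) := by rw [← hE]; exact hmarkov

end Obs

/-! ### Letting `δ → 0`, `R → ∞`: a.s. finiteness of `sup_t ∫₀ᵗ (2/Y² - 2/X²)` for `κ < 4` -/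

section Raw

variable (κ) in
/-- The **raw functional `P_t = ∫₀ᵗ (2/Y_s² - 2/X_s²) ds`** of the two frozen flows (no
stopping); on `{T_x = T_y = ∞}` it equals `log g_t'(x) - log g_t'(y)`.
[cite: RohdeSchramm2005, eq. (3.3)] -/
def sleLogDerivRaw (x y : ℝ) (t : ℝ≥0) (ω : ℝ≥0 → ℝ) : ℝ :=
  ∫ s in (0 : ℝ)..t, (2 / sleRealFlowStop κ y s.toNNReal ω ^ 2 - 2 / sleRealFlowStop κ x s.toNNReal ω ^ 2)

/-- **Monotonicity of the frozen flow in the starting point** before the swallowing time of the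
lower point: `0 < y ≤ x`, `t < T_y` ⇒ `0 < Y_t ≤ X_t` (the real flow is increasing in the
starting point, `map_ofReal_re_lt_of_lt`). [folklore] -/
theorem sleRealFlowStop_pos_and_le (hy : 0 < y) (hyx : y ≤ x) {ω : ℝ≥0 → ℝ} {t : ℝ≥0}
    (ht : (t : WithTop ℝ≥0) < swallowingTime (sleDriving κ ω) y) :
    0 < sleRealFlowStop κ y t ω ∧ sleRealFlowStop κ y t ω ≤ sleRealFlowStop κ x t ω := by
  have hW : Continuous (sleDriving κ ω) := continuous_sleDriving κ ω
  have hy0 : sleDriving κ ω 0 < y := by rw [sleDriving_zero]; exact hy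
  have hTx : (t : WithTop ℝ≥0) < swallowingTime (sleDriving κ ω) x :=
    lt_of_lt_of_le ht (swallowingTime_mono_right hW hy0 hyx)
  rw [sleRealFlowStop_apply, sleRealFlowStop_apply, realFlowStop_of_lt ht, realFlowStop_of_lt hTx]
  refine ⟨realFlow_pos hW hy0 ht, ?_⟩
  rw [realFlow_apply, realFlow_apply]
  rcases eq_or_lt_of_le hyx with h | h
  · rw [h]
  · linarith [map_ofReal_re_lt_of_lt hW hy0 h ht hTx]

/-- On `{T_y = ∞}` (with `0 < y ≤ x`) the raw rate `2/Y² - 2/X²` is non-negative and continuous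
in time, and the raw functional is non-decreasing in `t`. [folklore] -/
theorem sleLogDerivRaw_mono (hy : 0 < y) (hyx : y ≤ x) {ω : ℝ≥0 → ℝ}
    (hT : swallowingTime (sleDriving κ ω) y = ⊤) {t t' : ℝ≥0} (htt' : t ≤ t') :
    sleLogDerivRaw κ x y t ω ≤ sleLogDerivRaw κ x y t' ω := by
  have hx : 0 < x := hy.trans_le hyx
  have hpos : ∀ s : ℝ≥0, 0 < sleRealFlowStop κ y s ω ∧ sleRealFlowStop κ y s ω ≤ sleRealFlowStop κ x s ω :=
    fun s ↦ sleRealFlowStop_pos_and_le hy hyx (by rw [hT]; exact WithTop.coe_lt_top s)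
  have hnn : ∀ r : ℝ, 0 ≤ 2 / sleRealFlowStop κ y r.toNNReal ω ^ 2 - 2 / sleRealFlowStop κ x r.toNNReal ω ^ 2 := by
    intro r
    obtain ⟨h1, h2⟩ := hpos r.toNNReal
    exact sub_nonneg.2 (div_le_div_of_nonneg_left zero_le_two (pow_pos h1 2) (pow_le_pow_left₀ h1.le h2 2))
  have hc : Continuous fun r : ℝ ↦
      2 / sleRealFlowStop κ y r.toNNReal ω ^ 2 - 2 / sleRealFlowStop κ x r.toNNReal ω ^ 2 := by
    refine (continuous_const.div (((continuous_sleRealFlowStop hy.ne' ω).comp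
      continuous_real_toNNReal).pow 2) fun r ↦ (pow_pos (hpos _).1 2).ne').sub
      (continuous_const.div (((continuous_sleRealFlowStop hx.ne' ω).comp
      continuous_real_toNNReal).pow 2) fun r ↦ (pow_pos ((hpos _).1.trans_le (hpos _).2) 2).ne')
  exact intervalIntegral.integral_mono_interval le_rfl t.coe_nonneg (NNReal.coe_le_coe.2 htt')
    (Eventually.of_forall hnn) (hc.intervalIntegrable _ _)

/-- **The stopped functional is the raw one when neither flow has left `(δ, R)` by time `N`**:
if both frozen flows stay in `(δ, R)` on `[0, N]`, then `N < ρ = sleTwoFlowExit`, the stopped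
flows are the flows and the truncations are trivial on `[0, N]`. [folklore] -/
theorem sleLogDerivRate_sub_eq_raw (hδ : 0 < δ) (hδy : δ < y) (hyx : y ≤ x)
    {ω : ℝ≥0 → ℝ} {N : ℝ≥0}
    (hin : ∀ s : ℝ≥0, s ≤ N → sleRealFlowStop κ y s ω ∈ Ioo δ R ∧ sleRealFlowStop κ x s ω ∈ Ioo δ R) :
    sleLogDerivRate κ y x y δ R N ω - sleLogDerivRate κ x x y δ R N ω = sleLogDerivRaw κ x y N ω := by
  have hy : 0 < y := hδ.trans hδy
  have hx : 0 < x := hy.trans_le hyx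
  -- `N < ρ`
  have hNρ : (N : WithTop ℝ≥0) < sleTwoFlowExit κ x y δ R ω := by
    refine lt_min ?_ ?_
    · by_contra hle
      rw [not_lt, exitTime_le_coe_iff (continuous_sleRealFlowStop hx.ne' ω)] at hle
      obtain ⟨j, hj, hout⟩ := hle
      exact hout (hin j hj).2
    · by_contra hle
      rw [not_lt, exitTime_le_coe_iff (continuous_sleRealFlowStop hy.ne' ω)] at hle
      obtain ⟨j, hj, hout⟩ := hle
      exact hout (hin j hj).1
  have hle : ∀ s ∈ uIcc (0 : ℝ) N, ((s.toNNReal : ℝ≥0) : WithTop ℝ≥0) ≤ sleTwoFlowExit κ x y δ R ω := by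
    intro s hs
    rw [uIcc_of_le N.coe_nonneg] at hs
    exact (WithTop.coe_le_coe.2 (Real.toNNReal_le_iff_le_coe.2 hs.2)).trans hNρ.le
  have hAy : sleLogDerivRate κ y x y δ R N ω = ∫ s in (0 : ℝ)..N, 2 / sleRealFlowStop κ y s.toNNReal ω ^ 2 := by
    simp only [sleLogDerivRate, timeIntegral]
    refine intervalIntegral.integral_congr fun s hs ↦ ?_
    simp only [trunc_of_le (hle s hs), stoppedProcess_eq_of_le (hle s hs)]
  have hAx : sleLogDerivRate κ x x y δ R N ω = ∫ s in (0 : ℝ)..N, 2 / sleRealFlowStop κ x s.toNNReal ω ^ 2 := by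
    simp only [sleLogDerivRate, timeIntegral]
    refine intervalIntegral.integral_congr fun s hs ↦ ?_
    simp only [trunc_of_le (hle s hs), stoppedProcess_eq_of_le (hle s hs)]
  -- integrability on `[0, N]` (continuous positive integrands there)
  have hpos : ∀ s ∈ Icc (0 : ℝ) N, δ < sleRealFlowStop κ y s.toNNReal ω ∧ δ < sleRealFlowStop κ x s.toNNReal ω := by
    intro s hs
    have h := hin s.toNNReal (Real.toNNReal_le_iff_le_coe.2 hs.2)
    exact ⟨h.1.1, h.2.1⟩
  have hIy : IntervalIntegrable (fun s : ℝ ↦ 2 / sleRealFlowStop κ y s.toNNReal ω ^ 2) volume 0 N := by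
    refine (ContinuousOn.mono ?_ (by rw [uIcc_of_le N.coe_nonneg])).intervalIntegrable
    exact continuousOn_const.div ((((continuous_sleRealFlowStop hy.ne' ω).comp
      continuous_real_toNNReal).pow 2).continuousOn) fun s hs ↦ (pow_pos (hδ.trans (hpos s hs).1) 2).ne'
  have hIx : IntervalIntegrable (fun s : ℝ ↦ 2 / sleRealFlowStop κ x s.toNNReal ω ^ 2) volume 0 N := by
    refine (ContinuousOn.mono ?_ (by rw [uIcc_of_le N.coe_nonneg])).intervalIntegrable
    exact continuousOn_const.div ((((continuous_sleRealFlowStop hx.ne' ω).comp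
      continuous_real_toNNReal).pow 2).continuousOn) fun s hs ↦ (pow_pos (hδ.trans (hpos s hs).2) 2).ne'
  rw [hAy, hAx, sleLogDerivRaw, intervalIntegral.integral_sub hIy hIx]

variable (κ x y) in
/-- The event "**both frozen flows stay in `(y/(m+2), x+m+1)` on `[0, N]`**" (increasing in
`m`, and exhausting `{T_x = T_y = ∞}`). [folklore] -/
def sleFlowsInBox (N : ℝ≥0) (m : ℕ) : Set (ℝ≥0 → ℝ) :=
  {ω | ∀ s : ℝ≥0, s ≤ N → sleRealFlowStop κ y s ω ∈ Ioo (y / (m + 2)) (x + m + 1) ∧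
    sleRealFlowStop κ x s ω ∈ Ioo (y / (m + 2)) (x + m + 1)}

/-- The boxes increase with `m`. [folklore] -/
theorem monotone_sleFlowsInBox (hy : 0 < y) (N : ℝ≥0) : Monotone (sleFlowsInBox κ x y N) := by
  refine monotone_nat_of_le_succ fun m ω hω s hs ↦ ?_
  obtain ⟨⟨h1, h2⟩, h3, h4⟩ := hω s hs
  have hδ : y / ((m + 1 : ℕ) + 2) ≤ y / (m + 2) := by
    push_cast
    exact div_le_div_of_nonneg_left hy.le (by positivity) (by linarith)
  have hR : x + m + 1 ≤ x + ((m + 1 : ℕ) : ℝ) + 1 := by push_cast; linarith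
  exact ⟨⟨hδ.trans_lt h1, h2.trans_le hR⟩, hδ.trans_lt h3, h4.trans_le hR⟩

/-- **On `{T_x = T_y = ∞}` both flows stay in some box on `[0, N]`** (continuous positive paths
on a compact interval). [folklore] -/
theorem exists_mem_sleFlowsInBox (hy : 0 < y) (hyx : y ≤ x) {ω : ℝ≥0 → ℝ}
    (hTy : swallowingTime (sleDriving κ ω) y = ⊤) (N : ℝ≥0) : ∃ m, ω ∈ sleFlowsInBox κ x y N m := by
  have hx : 0 < x := hy.trans_le hyx
  have hpos : ∀ s : ℝ≥0, 0 < sleRealFlowStop κ y s ω ∧ sleRealFlowStop κ y s ω ≤ sleRealFlowStop κ x s ω :=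
    fun s ↦ sleRealFlowStop_pos_and_le hy hyx (by rw [hTy]; exact WithTop.coe_lt_top s)
  have hK : IsCompact (Icc (0 : ℝ≥0) N) := isCompact_Icc
  have hne : (Icc (0 : ℝ≥0) N).Nonempty := ⟨0, left_mem_Icc.2 bot_le⟩
  obtain ⟨s₀, -, hmin⟩ := hK.exists_isMinOn hne (continuous_sleRealFlowStop hy.ne' ω).continuousOn
  obtain ⟨s₁, -, hmax⟩ := hK.exists_isMaxOn hne (continuous_sleRealFlowStop hx.ne' ω).continuousOn
  set y₀ := sleRealFlowStop κ y s₀ ω with hy₀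
  set x₁ := sleRealFlowStop κ x s₁ ω with hx₁
  have hy₀pos : 0 < y₀ := (hpos s₀).1
  -- choose `m` with `y/(m+2) < y₀` and `x₁ < x + m + 1`
  obtain ⟨m₁, hm₁⟩ := exists_nat_gt (y / y₀)
  obtain ⟨m₂, hm₂⟩ := exists_nat_gt (x₁ - x)
  refine ⟨max m₁ m₂, fun s hs ↦ ?_⟩
  have hsmem : s ∈ Icc (0 : ℝ≥0) N := ⟨bot_le, hs⟩
  have hm : (max m₁ m₂ : ℝ) + 2 > y / y₀ := by
    have : (m₁ : ℝ) ≤ ((max m₁ m₂ : ℕ) : ℝ) := by exact_mod_cast le_max_left _ _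
    push_cast at this ⊢
    linarith
  have hδ : y / ((max m₁ m₂ : ℕ) + 2) < y₀ := by
    rw [div_lt_iff₀ (by positivity)]
    have := (div_lt_iff₀ hy₀pos).1 hm
    push_cast
    linarith
  have hR : x₁ < x + ((max m₁ m₂ : ℕ) : ℝ) + 1 := by
    have : (m₂ : ℝ) ≤ ((max m₁ m₂ : ℕ) : ℝ) := by exact_mod_cast le_max_right _ _
    linarith
  have hYlo : y₀ ≤ sleRealFlowStop κ y s ω := hmin hsmem
  have hXhi : sleRealFlowStop κ x s ω ≤ x₁ := hmax hsmem
  have hYX := (hpos s).2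
  exact ⟨⟨hδ.trans_le hYlo, by linarith⟩, by linarith, by linarith⟩

/-- **Tail bound for the raw functional**: for `0 < κ < 4`, `0 < y ≤ x`, `λ > 0` and every `N`,
`P[{λ ≤ P_N} ∩ {T_y = ∞}] ≤ (4/(4-κ)) log(x/y) / λ`. On the box events the raw functional is
the stopped one (`sleLogDerivRate_sub_eq_raw`), whose tail is bounded by Markov
(`measureReal_le_sleLogDerivRate_sub_le`); the boxes increase to cover `{T_y = ∞}`.
[cite: RohdeSchramm2005, proof of Lemma 7.2 (p. 909)] -/
theorem measure_le_sleLogDerivRaw_le (hκ : κ < 4) (hy : 0 < y) (hyx : y ≤ x) (N : ℝ≥0)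
    {lam : ℝ} (hlam : 0 < lam) :
    preWienerMeasure ({ω | lam ≤ sleLogDerivRaw κ x y N ω} ∩ {ω | swallowingTime (sleDriving κ ω) y = ⊤}) ≤
      ENNReal.ofReal (4 / (4 - (κ : ℝ)) * (Real.log x - Real.log y) / lam) := by
  haveI := isProbabilityMeasure_preWienerMeasure'
  set C : ℝ := 4 / (4 - (κ : ℝ)) * (Real.log x - Real.log y) / lam with hC
  set S : ℕ → Set (ℝ≥0 → ℝ) := fun m ↦ {ω | lam ≤ sleLogDerivRaw κ x y N ω} ∩ sleFlowsInBox κ x y N m with hS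
  have hSmono : Monotone S := fun m m' h ω hω ↦ ⟨hω.1, monotone_sleFlowsInBox hy N h hω.2⟩
  -- each `S m` has small probability
  have hSm : ∀ m, preWienerMeasure (S m) ≤ ENNReal.ofReal C := by
    intro m
    have hδ : 0 < y / (m + 2) := by positivity
    have hδy : y / (m + 2) < y := by
      rw [div_lt_iff₀ (by positivity)]
      nlinarith
    have hxR : x < x + m + 1 := by linarith [m.cast_nonneg (α := ℝ)]
    have hsub : S m ⊆ {ω | lam ≤ sleLogDerivRate κ y x y (y / (m + 2)) (x + m + 1) N ω -
        sleLogDerivRate κ x x y (y / (m + 2)) (x + m + 1) N ω} := by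
      rintro ω ⟨hω, hbox⟩
      show lam ≤ _
      rw [sleLogDerivRate_sub_eq_raw hδ hδy hyx hbox]
      exact hω
    have h := measureReal_le_sleLogDerivRate_sub_le (κ := κ) hδ hδy hyx hxR hκ N hlam
    calc preWienerMeasure (S m)
        ≤ preWienerMeasure {ω | lam ≤ sleLogDerivRate κ y x y (y / (m + 2)) (x + m + 1) N ω -
            sleLogDerivRate κ x x y (y / (m + 2)) (x + m + 1) N ω} := measure_mono hsub
      _ = ENNReal.ofReal (preWienerMeasure.real {ω | lam ≤ sleLogDerivRate κ y x y (y / (m + 2)) (x + m + 1) N ω -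
            sleLogDerivRate κ x x y (y / (m + 2)) (x + m + 1) N ω}) :=
          (ENNReal.ofReal_toReal (measure_ne_top _ _)).symm
      _ ≤ ENNReal.ofReal C := ENNReal.ofReal_le_ofReal h
  -- the union of the `S m` contains the event
  have hcover : {ω | lam ≤ sleLogDerivRaw κ x y N ω} ∩ {ω | swallowingTime (sleDriving κ ω) y = ⊤} ⊆ ⋃ m, S m := by
    rintro ω ⟨hω, hT⟩
    obtain ⟨m, hm⟩ := exists_mem_sleFlowsInBox hy hyx hT N
    exact mem_iUnion.2 ⟨m, hω, hm⟩
  refine (measure_mono hcover).trans ?_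
  exact le_of_tendsto' (tendsto_measure_iUnion_atTop hSmono) hSm

/-- **For `0 < κ < 4` and `0 < y ≤ x`, almost surely `sup_t ∫₀ᵗ (2/Y_s² - 2/X_s²) ds < ∞`.**
Both flows are a.s. never swallowed (`ae_sle_swallowingTime_eq_top_of_le_four`, `κ ≤ 4`); on that
event the raw functional is non-decreasing in `t`, and for every level `L` the event
`{sup_N P_N ≥ L}` is the increasing union of `{P_N ≥ L}`, of probability `≤ (4/(4-κ)) log(x/y)/L`
(`measure_le_sleLogDerivRaw_le`); hence `P[sup = ∞] = 0`. This is "`sup_t Q(t) < ∞` a.s." of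
Rohde–Schramm's proof of Lemma 7.2 (p. 909) in the variant `Q = log g'(x) - log g'(y)`, `κ < 4`.
[cite: RohdeSchramm2005, proof of Lemma 7.2 (p. 909)] -/
theorem ae_exists_forall_sleLogDerivRaw_le (hκ0 : 0 < κ) (hκ : κ < 4) (hy : 0 < y) (hyx : y ≤ x) :
    ∀ᵐ ω ∂preWienerMeasure, ∃ L : ℝ, ∀ t : ℝ≥0, sleLogDerivRaw κ x y t ω ≤ L := by
  haveI := isProbabilityMeasure_preWienerMeasure'
  set G : Set (ℝ≥0 → ℝ) := {ω | swallowingTime (sleDriving κ ω) y = ⊤} with hG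
  have hGae : ∀ᵐ ω ∂preWienerMeasure, ω ∈ G := ae_sle_swallowingTime_eq_top_of_le_four hκ0 hκ.le hy
  -- the bad event
  set Bad : Set (ℝ≥0 → ℝ) := {ω | ω ∈ G ∧ ∀ L : ℕ, ∃ N : ℕ, (L : ℝ) + 1 ≤ sleLogDerivRaw κ x y N ω} with hBad
  have hBadle : ∀ L : ℕ, preWienerMeasure Bad ≤
      ENNReal.ofReal (4 / (4 - (κ : ℝ)) * (Real.log x - Real.log y) / ((L : ℝ) + 1)) := by
    intro L
    set E : ℕ → Set (ℝ≥0 → ℝ) := fun N ↦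
      {ω | (L : ℝ) + 1 ≤ sleLogDerivRaw κ x y N ω} ∩ G with hE
    have hEmono : Monotone E := by
      refine monotone_nat_of_le_succ fun N ω hω ↦ ⟨?_, hω.2⟩
      exact le_trans hω.1 (sleLogDerivRaw_mono hy hyx hω.2 (by exact_mod_cast N.le_succ))
    have hsub : Bad ⊆ ⋃ N, E N := by
      rintro ω ⟨hωG, hω⟩
      obtain ⟨N, hN⟩ := hω L
      exact mem_iUnion.2 ⟨N, hN, hωG⟩
    refine (measure_mono hsub).trans (le_of_tendsto' (tendsto_measure_iUnion_atTop hEmono) fun N ↦ ?_)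
    exact measure_le_sleLogDerivRaw_le hκ hy hyx N (by positivity)
  have hBad0 : preWienerMeasure Bad = 0 := by
    have hlim : Tendsto (fun L : ℕ ↦ ENNReal.ofReal (4 / (4 - (κ : ℝ)) * (Real.log x - Real.log y) /
        ((L : ℝ) + 1))) atTop (𝓝 0) := by
      rw [← ENNReal.ofReal_zero]
      refine ENNReal.tendsto_ofReal ?_
      have h := tendsto_one_div_add_atTop_nhds_zero_nat.const_mul (4 / (4 - (κ : ℝ)) * (Real.log x - Real.log y))
      rw [mul_zero] at h
      refine h.congr fun L ↦ ?_
      ring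
    exact le_antisymm (ge_of_tendsto' hlim hBadle) bot_le
  filter_upwards [hGae, measure_eq_zero_iff_ae_notMem.1 hBad0] with ω hωG hωBad
  have h : ∃ L : ℕ, ∀ N : ℕ, sleLogDerivRaw κ x y N ω < (L : ℝ) + 1 := by
    by_contra hcon
    push Not at hcon
    exact hωBad ⟨hωG, hcon⟩
  obtain ⟨L, hL⟩ := h
  refine ⟨(L : ℝ) + 1, fun t ↦ ?_⟩
  have h1 := sleLogDerivRaw_mono hy hyx hωG (show t ≤ ((⌈(t : ℝ)⌉₊ : ℕ) : ℝ≥0) from by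
    rw [← NNReal.coe_le_coe]; push_cast; exact Nat.le_ceil _)
  exact h1.trans (hL _).le

/-- The same bound written with the (unfrozen) real flows `realFlow (√κ B) z` — which agree with
the frozen ones on `{T_y = ∞}` —, the form consumed with `log g_t'(x) = ∫₀ᵗ -2/X_s² ds`
(`LoewnerRealKoebe`): for `0 < κ < 4` and `0 < y ≤ x`, almost surely `T_y = ∞` and there is `L`
with `∫₀ᵗ (2/Y_s² - 2/X_s²) ds ≤ L` for all `t`. [cite: RohdeSchramm2005, proof of Lemma 7.2 (p. 909)] -/
theorem ae_exists_forall_integral_realFlow_rate_le (hκ0 : 0 < κ) (hκ : κ < 4) (hy : 0 < y) (hyx : y ≤ x) :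
    ∀ᵐ ω ∂preWienerMeasure, swallowingTime (sleDriving κ ω) y = ⊤ ∧ ∃ L : ℝ, ∀ t : ℝ≥0,
      ∫ s in (0 : ℝ)..t, (2 / realFlow (sleDriving κ ω) y s.toNNReal ^ 2 -
        2 / realFlow (sleDriving κ ω) x s.toNNReal ^ 2) ≤ L := by
  filter_upwards [ae_exists_forall_sleLogDerivRaw_le hκ0 hκ hy hyx,
    ae_sle_swallowingTime_eq_top_of_le_four hκ0 hκ.le hy] with ω hω hT
  obtain ⟨L, hL⟩ := hω
  refine ⟨hT, L, fun t ↦ ?_⟩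
  have hx : 0 < x := hy.trans_le hyx
  have hTx : swallowingTime (sleDriving κ ω) x = ⊤ := by
    apply le_antisymm le_top
    rw [← hT]
    exact swallowingTime_mono_right (continuous_sleDriving κ ω) (by rw [sleDriving_zero]; exact hy) hyx
  have heq : sleLogDerivRaw κ x y t ω = ∫ s in (0 : ℝ)..t, (2 / realFlow (sleDriving κ ω) y s.toNNReal ^ 2 -
      2 / realFlow (sleDriving κ ω) x s.toNNReal ^ 2) := by
    refine intervalIntegral.integral_congr fun s _ ↦ ?_
    simp only [sleRealFlowStop_apply]
    rw [realFlowStop_of_lt (by rw [hT]; exact WithTop.coe_lt_top _),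
      realFlowStop_of_lt (by rw [hTx]; exact WithTop.coe_lt_top _)]
  rw [← heq]
  exact hL t

end Raw

end Literature.Probability.RandomPlanarGeometry
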